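import Literature.NumberTheory.GaloisRepresentations.SUnitsValuation
import Literature.NumberTheory.GaloisRepresentations.UnramifiedRadicalDescentAbsolute
import HarnessLib

/-!
# Kummer theory on `E_S = 𝒪_{K_S,S}ˣ`: `p`-divisibility and `p`-torsion (NSW VIII §3, proof of
# (8.3.18); Harari Lemma 17.21 (a))

Topic `NumberTheory/GaloisRepresentations`; namespace
`Literature.NumberTheory.GaloisRepresentations.SUnits`.  THEOREMS ONLY (no definition, no named fact,
no `sorry`, no instance; D-0026).  Sequel of `SUnitsGaloisModule.lean` (A1: `sUnits`,
`sUnitsSubmodule`, `sUnitsModule`, **`sUnitsRestricted K S`** = `E_S` over `G_{K,S}`) and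
`SUnitsValuation.lean` (A1b: `valuation_eq_one_of_mem_sUnits`); brick (A1c) of lane «PT3-TC» of
cell `bsd-eis` (crux `GoodLatticeBDPValue`, stmt-BirchSwinnertonDyer-19032; road memo `PT3TC-ROAD.md`):
the two facts about the `G_{K,S}`-module `E_S` that turn the Kummer sequence
`0 → μ_p → E_S →(p)→ E_S → 0` (exact for `S ⊇ {v ∣ p}`) into the reduction
«`H³(U, μ_p) = 0` ⟸ `H²(U, E_S)` is `p`-divisible ∧ `H³(U, E_S)[p] = 0`» of NSW's proof of (8.3.18)
(`cd_p(G_S) ≤ 2`) via (8.3.11) (iii), (iv) — the tree's `ContinuousCohomologyDivisibleSequence`.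

Write `E_S` for the carrier of `sUnitsRestricted K S`, i.e.
`Representation.invariants ((sUnitsModule K S).toRepresentation.comp (ramificationSubgroup K S).subtype)`
(the `N_S`-invariant `S`-units of `K̄`, a `ℤ`-submodule of `sUnitsSubmodule K S`).

* §1 `root_mem_sUnits` — a root `α`, `α^n = x`, of an `S`-unit is an `S`-unit (any field over `K`);
  **`smul_root_eq_self_of_mem_ramificationSubgroup`** — for `S ⊇ {v ∣ p}`, a `p`-th root `α ∈ K̄` of
  an `N_S`-fixed `S`-unit `x` is `N_S`-fixed: `K_S(α)/K_S` would be unramified outside `S`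
  (inertia at `v ∉ S` fixes `α` because `ord_w(x) = 0` and `w ∤ p` — the tree's
  `smul_root_eq_of_mem_inertia_of_dvd` on a finite Galois hull `L ⊆ K_S` of `x, ζ_p`, exactly as in
  `UnramifiedRadicalDescentAbsolute.exists_pow_eq_mul_pow_of_smul_invariant`).
* §2 **`zsmul_surjective_sUnitsRestricted`** — `E_S` is `p`-DIVISIBLE for `S ⊇ {v ∣ p}` (Harari
  Lemma 17.21 (a); NSW proof of (8.3.18): "`𝒪_S^× →(p)→ 𝒪_S^×` is surjective since `p ∈ S`").
* §3 the `p`-TORSION of `E_S` is `μ_p(K̄)`: `mem_torsionBy_sUnitsRestricted_iff`,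
  **`sUnitsRestricted_apply_eq_self_of_mem_torsionBy`** (every `σ ∈ Γ_K` fixing `μ_p` acts trivially
  on `E_S[p]`), **`natCard_torsionBy_sUnitsRestricted`** (`#E_S[p] = p`).

HONEST FRAMING: elementary Kummer/valuation facts about `S`-units; no cohomology is computed here and
no case of Poitou–Tate / BSD is proved.

## References
* J. Neukirch, A. Schmidt, K. Wingberg, *Cohomology of Number Fields*, 2nd ed. (2008), VIII §3,
  proof of (8.3.18) (the Kummer sequence on `E_S = 𝒪_{k_S,S}^×`), (8.3.11). [NeukirchSchmidtWingberg2008]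
* D. Harari, *Galois Cohomology and Class Field Theory* (2020), §17.4, Lemma 17.21 (a)
  (`E_S` is `ℓ`-divisible for `ℓ ∈ 𝒪_{k,S}^*`). [Harari2020]
-/

noncomputable section

open scoped NumberField nonZeroDivisors IntermediateField
open NumberField IsDedekindDomain IsDedekindDomain.HeightOneSpectrum Field WithZero IntermediateField
open Literature.NumberTheory.GaloisRepresentations.LocalWeilDatum
open Literature.NumberTheory.GaloisRepresentations.DiscreteGaloisModule

namespace Literature.NumberTheory.GaloisRepresentations.SUnits

/-! ### §1. Roots of `S`-units -/

section Root

variable {K : Type} [Field K] [NumberField K] {S : Set (HeightOneSpectrum (𝓞 K))}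
  {L : Type} [Field L] [Algebra K L]

/-- **A root of an `S`-unit is an `S`-unit**: if `α ^ n = x` (`n ≥ 1`) with `x ∈ 𝒪_{L,S}ˣ` then
`α ∈ 𝒪_{L,S}ˣ` (`α` and `α⁻¹` are integral over `𝒪_{K,S}` since their `n`-th powers are).
[cite: NeukirchSchmidtWingberg2008, VIII §3 (proof of (8.3.18))] [cite: Harari2020, Lemma 17.21 (a)] -/
theorem root_mem_sUnits {x α : Lˣ} {n : ℕ} (hn : 0 < n) (hα : α ^ n = x) (hx : x ∈ sUnits K S L) :
    α ∈ sUnits K S L := by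
  refine ⟨IsIntegral.of_pow hn ?_, IsIntegral.of_pow hn ?_⟩
  · rw [← Units.val_pow_eq_pow_val, hα]; exact hx.1
  · rw [← Units.val_pow_eq_pow_val, inv_pow, hα]
    exact hx.2

end Root

section Bar

variable (K : Type) [Field K] [NumberField K] (S : Set (HeightOneSpectrum (𝓞 K))) {p : ℕ}
  [hp : Fact p.Prime]

/-- **A `p`-th root of an `N_S`-fixed `S`-unit is `N_S`-fixed** (`S ⊇ {v ∣ p}`): for `x ∈ 𝒪_{K̄,S}ˣ`
fixed by `N_S` (so `x ∈ K_S`) and `α ∈ K̄` with `α^p = x`, every `g ∈ N_S` fixes `α` — i.e.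
`K_S(α) ⊆ K_S`: on a finite Galois hull `L ⊆ K_S` of `x` and `ζ_p`, `L(α)/L` is unramified at every
`w ∤ S` because `ord_w(x) = 0` (`x` is an `S`-unit, `valuation_eq_one_of_mem_sUnits`) and `w ∤ p`
(tree `smul_root_eq_of_mem_inertia_of_dvd`), so every inertia group outside `S`, hence `N_S`, fixes
`α` (`ramificationSubgroup_le_of_inertia_le`).  The argument of
`UnramifiedRadicalDescentAbsolute.exists_pow_eq_mul_pow_of_smul_invariant`, with `b := x`, `d := p`.
[cite: NeukirchSchmidtWingberg2008, VIII §3 (proof of (8.3.18): `p ∈ S`)] [cite: Harari2020, Lemma 17.21 (a)] -/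
theorem smul_root_eq_self_of_mem_ramificationSubgroup
    (hSp : ∀ v : HeightOneSpectrum (𝓞 K), ((p : ℕ) : 𝓞 K) ∈ v.asIdeal → v ∈ S)
    {x : (AlgebraicClosure K)ˣ} (hxS : x ∈ sUnits K S (AlgebraicClosure K))
    (hxN : ∀ g ∈ ramificationSubgroup K S, g • x = x)
    {α : AlgebraicClosure K} (hα : α ^ p = (x : AlgebraicClosure K))
    {g : absoluteGaloisGroup K} (hg : g ∈ ramificationSubgroup K S) : g • α = α := by
  classical
  have hpp : p.Prime := hp.out
  have hp0 : 0 < p := hpp.pos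
  -- a primitive `p`-th root of unity, fixed by `N_S`
  haveI : NeZero ((p : ℕ) : AlgebraicClosure K) := ⟨Nat.cast_ne_zero.mpr hpp.ne_zero⟩
  obtain ⟨ζ, hζ⟩ := HasEnoughRootsOfUnity.exists_primitiveRoot (AlgebraicClosure K) p
  have hζN : ∀ g ∈ ramificationSubgroup K S, g • ζ = ζ := fun g hg =>
    smul_eq_self_of_mem_ramificationSubgroup_of_pow_eq_one K hSp (n := 1)
      (by rw [pow_one]; exact hζ.pow_eq_one) hg
  have hxN' : ∀ g ∈ ramificationSubgroup K S, g • (x : AlgebraicClosure K) = x := fun g hg => by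
    rw [← Units.coe_smul, hxN g hg]
  -- a finite Galois hull `L ⊆ K_S` of `x` and `ζ`
  set T : Set (AlgebraicClosure K) := {(x : AlgebraicClosure K), ζ} with hT
  have hTfin : T.Finite := (Set.finite_singleton ζ).insert _
  have hTfix : ∀ t ∈ T, ∀ g ∈ ramificationSubgroup K S, g • t = t := by
    rintro t ht g hg
    rcases ht with rfl | ht
    · exact hxN' g hg
    · rw [Set.mem_singleton_iff.mp ht]; exact hζN g hg
  obtain ⟨L, hLfin, hLgal, hTL, hLN⟩ :=
    exists_isGalois_subset_ramificationSubgroup_le_galFixing K hTfin hTfix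
  haveI := hLfin
  haveI := hLgal
  haveI : NumberField L := NumberField.of_module_finite K L
  have hxL : (x : AlgebraicClosure K) ∈ L := hTL (Or.inl rfl)
  have hζL : ζ ∈ L := hTL (Or.inr rfl)
  set xL : L := ⟨x, hxL⟩ with hxLdef
  have hxL0 : xL ≠ 0 := fun h0 => x.ne_zero (congrArg Subtype.val h0)
  -- `xL` is an `S`-unit of `L`
  set xLu : Lˣ := Units.mk0 xL hxL0 with hxLu
  have hxLuS : xLu ∈ sUnits K S L := by
    have hmap : Units.map ((IntermediateField.val L : L →ₐ[K] AlgebraicClosure K) :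
        L →* AlgebraicClosure K) xLu = x := Units.ext rfl
    rw [← map_mem_sUnits_iff (IntermediateField.val L : L →ₐ[K] AlgebraicClosure K) xLu, hmap]
    exact hxS
  have hα' : α ^ p = algebraMap L (AlgebraicClosure K) xL := hα
  set ζL : L := ⟨ζ, hζL⟩ with hζLdef
  have hζL' : IsPrimitiveRoot ζL p :=
    IsPrimitiveRoot.of_map_of_injective (f := algebraMap L (AlgebraicClosure K))
      (by exact hζ) (algebraMap L (AlgebraicClosure K)).injective
  -- `α` is fixed by every inertia group outside `S`
  have hαI : ∀ v ∉ S, ∀ 𝔓 ∈ v.primesAbove, ∀ σ ∈ 𝔓.inertia (absoluteGaloisGroup K), σ • α = α := by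
    intro v hv 𝔓 h𝔓 σ hσ
    haveI : 𝔓.IsPrime := h𝔓.1
    have hσL : σ ∈ galFixing K L := hLN (inertia_le_ramificationSubgroup hv h𝔓 hσ)
    -- `σ` as an `L`-automorphism of `K̄`
    let σL : AlgebraicClosure K ≃ₐ[L] AlgebraicClosure K :=
      { absoluteGaloisGroup.toAlgEquiv K σ with
        commutes' := fun y => (mem_galFixing_iff K).mp hσL y y.2 }
    have hσLapply : ∀ y : AlgebraicClosure K, σL y = σ • y := fun y => rfl
    -- the prime of the integral closure of `𝓞 L` in `K̄` below `𝔓`, and the place `w` of `L`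
    let ι : integralClosure (𝓞 L) (AlgebraicClosure K) →+* absIntegers (𝓞 K) K :=
      (integralClosure (𝓞 L) (AlgebraicClosure K)).val.toRingHom.codRestrict (absIntegers (𝓞 K) K)
        fun y => by
          rw [mem_integralClosure_iff]
          exact (isIntegral_trans (R := ℤ) (A := 𝓞 L) (y : AlgebraicClosure K) y.2).tower_top
    set 𝔓' : Ideal (integralClosure (𝓞 L) (AlgebraicClosure K)) := 𝔓.comap ι with h𝔓'def
    haveI h𝔓'prime : 𝔓'.IsPrime := Ideal.comap_isPrime ι 𝔓
    set W : Ideal (𝓞 L) := 𝔓'.under (𝓞 L) with hWdef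
    have hWv : W.under (𝓞 K) = v.asIdeal := by
      ext y
      rw [Ideal.under, Ideal.mem_comap, hWdef, Ideal.under, Ideal.mem_comap, h𝔓'def,
        Ideal.mem_comap, h𝔓.2.over, Ideal.under, Ideal.mem_comap]
      exact Iff.rfl
    have hW0 : W ≠ ⊥ := fun h0 => v.ne_bot (by
      rw [← hWv, h0]
      exact Ideal.comap_bot_of_injective _ (FaithfulSMul.algebraMap_injective (𝓞 K) (𝓞 L)))
    let w : HeightOneSpectrum (𝓞 L) := ⟨W, Ideal.IsPrime.under (𝓞 L) 𝔓', hW0⟩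
    haveI : 𝔓'.LiesOver w.asIdeal := ⟨rfl⟩
    have hwv : w.under (𝓞 K) = v := HeightOneSpectrum.ext hWv
    have hwS : w.under (𝓞 K) ∉ S := by rw [hwv]; exact hv
    -- `w ∤ p`
    have hpv : ((p : ℕ) : 𝓞 K) ∉ v.asIdeal := fun hpv => hv (hSp v hpv)
    have hdw : ((p : ℕ) : 𝓞 L) ∉ w.asIdeal := by
      intro hdw
      apply hpv
      rw [← hwv]
      change algebraMap (𝓞 K) (𝓞 L) (p : 𝓞 K) ∈ w.asIdeal
      rwa [map_natCast]
    -- `p ∣ ord_w(x) = 0`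
    have hdvd : (p : ℤ) ∣ log (w.valuation L xL) := by
      have h1 : w.valuation L (xLu : L) = 1 := valuation_eq_one_of_mem_sUnits hxLuS w hwS
      have h2 : (xLu : L) = xL := rfl
      rw [h2] at h1
      rw [h1, log_one]
      exact dvd_zero _
    -- `σ` is an inertia element at `𝔓'`
    have hσ' : σL ∈ 𝔓'.inertia (AlgebraicClosure K ≃ₐ[L] AlgebraicClosure K) := by
      rw [Ideal.inertia, AddSubgroup.mem_inertia]
      intro y
      change ι (σL • y - y) ∈ 𝔓
      rw [map_sub]
      have hy : ι (σL • y) = σ • ι y := Subtype.ext (by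
        change ((σL • y : integralClosure (𝓞 L) (AlgebraicClosure K)) : AlgebraicClosure K) =
          σ • (y : AlgebraicClosure K)
        rw [integralClosure.coe_smul]
        rfl)
      rw [hy]
      rw [Ideal.inertia, AddSubgroup.mem_inertia] at hσ
      exact hσ (ι y)
    have key := smul_root_eq_of_mem_inertia_of_dvd hp0 hζL' hxL0 w hdw hdvd hα' 𝔓' hσ'
    rwa [hσLapply] at key
  -- hence by `N_S`
  have hle : ramificationSubgroup K S ≤ galFixing K K⟮α⟯ :=
    ramificationSubgroup_le_of_inertia_le K (isClosed_galFixing K K⟮α⟯) fun v hv 𝔓 h𝔓 σ hσ =>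
      (mem_galFixing_iff K).mpr fun y hy =>
        smul_eq_self_of_mem_adjoin K (S := {α}) (fun z hz => by
          rw [Set.mem_singleton_iff.mp hz]; exact hαI v hv 𝔓 h𝔓 σ hσ) hy
  exact (mem_galFixing_iff K).mp (hle hg) α (mem_adjoin_simple_self K α)

/-! ### §2. `E_S` is `p`-divisible -/

/-- **`E_S = 𝒪_{K_S,S}ˣ` is `p`-divisible for `S ⊇ {v ∣ p}`** (Harari Lemma 17.21 (a); NSW, proof of
(8.3.18): the Kummer sequence `0 → μ_p → E_S →(p)→ E_S → 0` is exact): multiplication by `p` on the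
`ℤ`-module underlying `sUnitsRestricted K S` is onto — a `p`-th root of an `N_S`-fixed `S`-unit of `K̄`
is again an `N_S`-fixed `S`-unit (§1).
[cite: Harari2020, §17.4 Lemma 17.21 (a)] [cite: NeukirchSchmidtWingberg2008, VIII §3 (proof of (8.3.18))] -/
theorem zsmul_surjective_sUnitsRestricted
    (hSp : ∀ v : HeightOneSpectrum (𝓞 K), ((p : ℕ) : 𝓞 K) ∈ v.asIdeal → v ∈ S) :
    Function.Surjective fun w : Representation.invariants
        ((sUnitsModule K S).toRepresentation.comp (ramificationSubgroup K S).subtype) ↦ (p : ℤ) • w := by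
  have hpp : p.Prime := hp.out
  intro w
  -- the underlying `S`-unit `x ∈ K̄ˣ`, fixed by `N_S`
  set x : (AlgebraicClosure K)ˣ :=
    (UnitsCarrier.toAdditive (((w : Representation.invariants ((sUnitsModule K S).toRepresentation.comp (ramificationSubgroup K S).subtype)) : sUnitsSubmodule K S) : UnitsCarrier K)).toMul
    with hxdef
  have hxS : x ∈ sUnits K S (AlgebraicClosure K) :=
    (mem_sUnitsSubmodule_iff K S _).mp ((w : Representation.invariants ((sUnitsModule K S).toRepresentation.comp (ramificationSubgroup K S).subtype)) : sUnitsSubmodule K S).2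
  have hxN : ∀ g ∈ ramificationSubgroup K S, g • x = x := by
    intro g hg
    have h1 := w.2 ⟨g, hg⟩
    have h2 := congrArg (fun u : sUnitsSubmodule K S ↦ UnitsCarrier.toAdditive (u : UnitsCarrier K)) h1
    change UnitsCarrier.toAdditive (units K g _) = _ at h2
    rw [units_apply_apply] at h2
    exact Additive.ofMul.injective h2
  -- a `p`-th root `α`, an `N_S`-fixed `S`-unit
  obtain ⟨α, hα⟩ := IsAlgClosed.exists_pow_nat_eq (x : AlgebraicClosure K) hpp.pos
  have hα0 : α ≠ 0 := fun h0 => x.ne_zero (by rw [← hα, h0, zero_pow hpp.ne_zero])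
  set αu : (AlgebraicClosure K)ˣ := Units.mk0 α hα0 with hαu
  have hαux : αu ^ p = x := Units.ext (by rw [Units.val_pow_eq_pow_val, Units.val_mk0, hα])
  have hαS : αu ∈ sUnits K S (AlgebraicClosure K) := root_mem_sUnits hpp.pos hαux hxS
  have hαN : ∀ g ∈ ramificationSubgroup K S, g • αu = αu := fun g hg =>
    Units.ext (by
      rw [Units.coe_smul, Units.val_mk0]
      exact smul_root_eq_self_of_mem_ramificationSubgroup K S hSp hxS hxN hα hg)
  -- the element of `E_S` it defines
  have hαmem : UnitsCarrier.ofUnits αu ∈ sUnitsSubmodule K S := hαS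
  have hαinv : (⟨UnitsCarrier.ofUnits αu, hαmem⟩ : sUnitsSubmodule K S) ∈
      Representation.invariants
        ((sUnitsModule K S).toRepresentation.comp (ramificationSubgroup K S).subtype) := by
    rw [Representation.mem_invariants]
    intro g
    apply Subtype.ext
    change units K (g : absoluteGaloisGroup K) (UnitsCarrier.ofUnits αu) = UnitsCarrier.ofUnits αu
    apply UnitsCarrier.toAdditive.injective
    rw [units_apply_apply]
    change Additive.ofMul ((g : absoluteGaloisGroup K) • αu) = Additive.ofMul αu
    rw [hαN g g.2]
  refine ⟨⟨⟨UnitsCarrier.ofUnits αu, hαmem⟩, hαinv⟩, ?_⟩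
  apply Subtype.ext
  apply Subtype.ext
  change (p : ℤ) • UnitsCarrier.ofUnits αu =
    (((w : Representation.invariants ((sUnitsModule K S).toRepresentation.comp (ramificationSubgroup K S).subtype)) : sUnitsSubmodule K S) : UnitsCarrier K)
  apply UnitsCarrier.toAdditive.injective
  change Additive.ofMul (αu ^ (p : ℤ)) = Additive.ofMul x
  rw [zpow_natCast, hαux]

/-! ### §3. The `p`-torsion of `E_S` is `μ_p` -/

omit hp in
/-- Membership in the `p`-torsion `E_S[p]`: the underlying unit of `K̄` is a `p`-th root of unity.
[cite: NeukirchSchmidtWingberg2008, VIII §3 (proof of (8.3.18): `μ_p ⊂ 𝒪_S^×`)] -/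
theorem mem_torsionBy_sUnitsRestricted_iff
    (w : Representation.invariants
      ((sUnitsModule K S).toRepresentation.comp (ramificationSubgroup K S).subtype)) :
    w ∈ Submodule.torsionBy ℤ _ (p : ℤ) ↔
      (UnitsCarrier.toAdditive (((w : Representation.invariants ((sUnitsModule K S).toRepresentation.comp (ramificationSubgroup K S).subtype)) : sUnitsSubmodule K S) :
        UnitsCarrier K)).toMul ^ p = 1 := by
  rw [Submodule.mem_torsionBy_iff]
  constructor
  · intro h
    have h1 := congrArg
      (fun u : Representation.invariants
        ((sUnitsModule K S).toRepresentation.comp (ramificationSubgroup K S).subtype) ↦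
          UnitsCarrier.toAdditive (((u : Representation.invariants ((sUnitsModule K S).toRepresentation.comp (ramificationSubgroup K S).subtype)) : sUnitsSubmodule K S) :
            UnitsCarrier K)) h
    change (p : ℤ) • UnitsCarrier.toAdditive _ = UnitsCarrier.toAdditive 0 at h1
    rw [map_zero] at h1
    have h2 := congrArg Additive.toMul h1
    rwa [toMul_zsmul, toMul_zero, zpow_natCast] at h2
  · intro h
    apply Subtype.ext
    apply Subtype.ext
    apply UnitsCarrier.toAdditive.injective
    change (p : ℤ) • UnitsCarrier.toAdditive
        (((w : Representation.invariants ((sUnitsModule K S).toRepresentation.comp (ramificationSubgroup K S).subtype)) : sUnitsSubmodule K S) : UnitsCarrier K) =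
      UnitsCarrier.toAdditive 0
    rw [map_zero]
    apply Additive.toMul.injective
    rw [toMul_zsmul, toMul_zero, zpow_natCast, h]

omit hp in
/-- **`Γ_K`-elements fixing `μ_p` act trivially on `E_S[p]`**: if `σ` fixes every `p`-th root of
unity of `K̄` then `sUnitsRestricted K S σ̄ w = w` for every `w ∈ E_S[p]` (so over an open
`U ≤ G_{K,S}` fixing `μ_p` the `p`-torsion `E_S[p] ≅ μ_p ≅ ℤ/p` is the TRIVIAL module — the
coefficient module of (H3μ)). [cite: NeukirchSchmidtWingberg2008, VIII §3 (proof of (8.3.18))] -/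
theorem sUnitsRestricted_apply_eq_self_of_mem_torsionBy {σ : absoluteGaloisGroup K}
    (hσ : ∀ ζ : rootsOfUnity p (AlgebraicClosure K), σ • (ζ : (AlgebraicClosure K)ˣ) = ζ)
    {w : Representation.invariants
      ((sUnitsModule K S).toRepresentation.comp (ramificationSubgroup K S).subtype)}
    (hw : w ∈ Submodule.torsionBy ℤ _ (p : ℤ)) :
    sUnitsRestricted K S (toUnramifiedQuot K S σ) w = w := by
  have hroot := (mem_torsionBy_sUnitsRestricted_iff K S w).mp hw
  set x : (AlgebraicClosure K)ˣ :=
    (UnitsCarrier.toAdditive (((w : Representation.invariants ((sUnitsModule K S).toRepresentation.comp (ramificationSubgroup K S).subtype)) : sUnitsSubmodule K S) :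
      UnitsCarrier K)).toMul with hxdef
  have hxfix : σ • x = x := hσ ⟨x, (mem_rootsOfUnity p x).mpr hroot⟩
  rw [show toUnramifiedQuot K S σ = (σ : GaloisGroupUnramifiedOutside K S) from rfl]
  apply Subtype.ext
  rw [sUnitsRestricted_apply_coe]
  apply Subtype.ext
  rw [sUnitsModule_apply_coe]
  apply UnitsCarrier.toAdditive.injective
  rw [units_apply_apply]
  change Additive.ofMul (σ • x) = Additive.ofMul x
  rw [hxfix]

/-- **`#E_S[p] = p`**: the `p`-torsion of `E_S` is exactly `μ_p(K̄)` (roots of unity are `S`-units,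
`mem_sUnits_of_pow_eq_one`, and are fixed by `N_S` for `S ⊇ {v ∣ p}`,
`smul_eq_self_of_mem_ramificationSubgroup_of_pow_eq_one`), a group of order `p`.
[cite: NeukirchSchmidtWingberg2008, VIII §3 (proof of (8.3.18): `μ_p ⊂ 𝒪_S^×`)] [cite: Harari2020, Lemma 17.21 (a)] -/
theorem natCard_torsionBy_sUnitsRestricted
    (hSp : ∀ v : HeightOneSpectrum (𝓞 K), ((p : ℕ) : 𝓞 K) ∈ v.asIdeal → v ∈ S) :
    Nat.card (Submodule.torsionBy ℤ (Representation.invariants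
      ((sUnitsModule K S).toRepresentation.comp (ramificationSubgroup K S).subtype)) (p : ℤ)) = p := by
  have hpp : p.Prime := hp.out
  haveI : NeZero p := ⟨hpp.ne_zero⟩
  haveI : NeZero ((p : ℕ) : AlgebraicClosure K) := ⟨Nat.cast_ne_zero.mpr hpp.ne_zero⟩
  -- every `p`-th root of unity gives an element of `E_S[p]`
  have hmemS : ∀ ζ : rootsOfUnity p (AlgebraicClosure K),
      UnitsCarrier.ofUnits (ζ : (AlgebraicClosure K)ˣ) ∈ sUnitsSubmodule K S := fun ζ =>
    mem_sUnits_of_pow_eq_one hpp.pos ((mem_rootsOfUnity p _).mp ζ.2)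
  have hinv : ∀ ζ : rootsOfUnity p (AlgebraicClosure K),
      (⟨UnitsCarrier.ofUnits (ζ : (AlgebraicClosure K)ˣ), hmemS ζ⟩ : sUnitsSubmodule K S) ∈
        Representation.invariants
          ((sUnitsModule K S).toRepresentation.comp (ramificationSubgroup K S).subtype) := by
    intro ζ
    rw [Representation.mem_invariants]
    intro g
    apply Subtype.ext
    change units K (g : absoluteGaloisGroup K) (UnitsCarrier.ofUnits (ζ : (AlgebraicClosure K)ˣ)) =
      UnitsCarrier.ofUnits (ζ : (AlgebraicClosure K)ˣ)
    apply UnitsCarrier.toAdditive.injective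
    rw [units_apply_apply]
    change Additive.ofMul ((g : absoluteGaloisGroup K) • (ζ : (AlgebraicClosure K)ˣ)) =
      Additive.ofMul (ζ : (AlgebraicClosure K)ˣ)
    congr 1
    apply Units.ext
    rw [Units.coe_smul]
    exact smul_eq_self_of_mem_ramificationSubgroup_of_pow_eq_one K hSp (n := 1)
      (by rw [pow_one, ← Units.val_pow_eq_pow_val, (mem_rootsOfUnity p _).mp ζ.2, Units.val_one]) g.2
  have htors : ∀ ζ : rootsOfUnity p (AlgebraicClosure K),
      (⟨⟨UnitsCarrier.ofUnits (ζ : (AlgebraicClosure K)ˣ), hmemS ζ⟩, hinv ζ⟩ :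
        Representation.invariants
          ((sUnitsModule K S).toRepresentation.comp (ramificationSubgroup K S).subtype)) ∈
        Submodule.torsionBy ℤ _ (p : ℤ) := fun ζ => by
    rw [mem_torsionBy_sUnitsRestricted_iff]
    exact (mem_rootsOfUnity p _).mp ζ.2
  -- the bijection `μ_p(K̄) ≃ E_S[p]`
  let e : rootsOfUnity p (AlgebraicClosure K) ≃
      Submodule.torsionBy ℤ (Representation.invariants
        ((sUnitsModule K S).toRepresentation.comp (ramificationSubgroup K S).subtype)) (p : ℤ) :=
    { toFun := fun ζ => ⟨_, htors ζ⟩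
      invFun := fun w => ⟨(UnitsCarrier.toAdditive
          ((((w : Representation.invariants ((sUnitsModule K S).toRepresentation.comp (ramificationSubgroup K S).subtype))) : sUnitsSubmodule K S) : UnitsCarrier K)).toMul,
        (mem_rootsOfUnity p _).mpr ((mem_torsionBy_sUnitsRestricted_iff K S _).mp w.2)⟩
      left_inv := fun ζ => by ext; rfl
      right_inv := fun w => by
        apply Subtype.ext; apply Subtype.ext; apply Subtype.ext
        rfl }
  rw [← Nat.card_congr e]
  exact HasEnoughRootsOfUnity.natCard_rootsOfUnity (AlgebraicClosure K) p

end Bar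

end Literature.NumberTheory.GaloisRepresentations.SUnits

end
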